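import Mathlib
import Literature.Analysis.FluidPDE.NSSerrinRegularityProofs
import Literature.Analysis.FluidPDE.AxisymNoSwirlScaleInvariantBounds
import Summits.NavierStokesRegularity.NavierStokesRegularity.Theorems.L3TimeExponentPincerQuantJaw
import HarnessLib.Audit
import HarnessLib

/-!
# L3TimeExponentPincer — the critical modulus (ROUND-12, seat nsreg-p2)

Support kernel for the crux `L3CascadeJaw` (route `L3TimeExponentPincer`), continuing
`…Theorems.L3TimeExponentPincerQuantJaw` (ROUND-11: the uniform jaw is false above the energy line;
the data-critical jaw `QuantJawData q` survives and implies the crux).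

* `lintegral_enorm_rpow_three_le`, `eLpNorm_three_rpow_le_of_top_two` — the interpolation
  `‖f‖₃^q ≤ ‖f‖_∞^{q/3} (∫|f|²)^{q/3}`;
  `lpTime_three_le_of_top_two` — **the interpolation jaw**: a sup-norm envelope
  `‖u(t)‖_∞ ≤ c·g(t)` and an energy level `∫|u(t)|² ≤ e` on `(0,T)` give
  `∫₀ᵀ‖u‖₃^q ≤ c^{q/3} e^{q/3} ∫₀ᵀ g^{q/3}`.
* `CritSmoothing Φ` — the SCALE-INVARIANT PARABOLIC SMOOTHING MODULUS at the critical index: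
  `‖u(t)‖_∞ ≤ √ν Φ(‖u₀‖₃/ν) t^{-1/2}` for every frame solution (`ν`-covariant form of
  `√t‖u(t)‖_∞ ≤ Φ(‖u₀‖₃)` at `ν = 1`); `CritSmoothingB := ∃ Φ, CritSmoothing Φ`.
  `quantJawData_of_critSmoothing` (kernel): `CritSmoothing Φ → QuantJawData q` for EVERY `0 ≤ q < 6`
  (`∫₀ᵀ t^{-q/6} < ∞`), hence `l3CascadeJaw_of_critSmoothing` BY NAME.
* `lpTime_three_le_noSwirl_of_velocitySupDecay` — **the swirl-free Γ-jaw is a theorem** modulo the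
  named Literature fact `GallaySverak2015.VelocitySupDecay` ((1.12): `√t‖u(t)‖_∞ ≤ C(‖ω_θ(0)‖_{L¹(Ω)})`):
  along a Tao-class axisymmetric swirl-free solution (`ν = 1`) with `ω_θ(0) ∈ L¹(Ω)` and energy level
  `e`, `∫₀ᵀ‖u‖₃^q ≤ C(M)^{q/3} e^{q/3} ∫₀ᵀ t^{-q/6} dt` for every `0 ≤ q` (finite for `q < 6`):
  a VORTICITY-indexed modulus (`M = ‖ω_θ(0)‖_{L¹(drdz)}`), not a velocity-indexed one.
* `CritSmoothingNoSwirl Φ` / `CritSmoothingNoSwirlB` — the VELOCITY-indexed critical modulus in the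
  swirl-free class (the memo's typed «first statement not in print») and its kernel consequence
  `lpTime_three_le_noSwirl_of_critSmoothingNoSwirl` (the A-indexed swirl-free jaw for all `q < 6`).
* `ring_saturation_identity` — the real identity `E^{q/3} Γ^{q/3} (E²/Γ⁴)^{1-q/6} = E² Γ^{q-4}`:
  at the ring lifetime `T = ℓ²/ν = E²/Γ⁴` the Γ-jaw equals ROUND-11's persistence floor `E²Γ^{q-4}`.
-/

namespace Summit.NavierStokesRegularity.NavierStokesRegularity.Theorems.L3TimeExponentPincerCritModulus

open MeasureTheory Set Literature.Analysis.FluidPDE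
open Summit.NavierStokesRegularity.NavierStokesRegularity.Theorems.L3TimeExponentPincerQuantJaw
open scoped ENNReal NNReal

/-! ### Interpolation `L³ ⊂ L² ∩ L^∞` in the jaw's currency -/

section Interpolation

variable {α : Type*} [MeasurableSpace α] {μ : Measure α} {F : Type*} [NormedAddCommGroup F]

/-- `∫ ‖f‖³ ≤ ‖f‖_∞ · ∫ ‖f‖²`. -/
theorem lintegral_enorm_rpow_three_le {f : α → F} (hf : AEStronglyMeasurable f μ) :
    ∫⁻ x, ‖f x‖ₑ ^ (3 : ℝ) ∂μ ≤ eLpNorm f ∞ μ * ∫⁻ x, ‖f x‖ₑ ^ 2 ∂μ := by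
  have hae : ∀ᵐ x ∂μ, ‖f x‖ₑ ≤ eLpNorm f ∞ μ := by
    rw [eLpNorm_exponent_top]
    exact enorm_ae_le_eLpNormEssSup f μ
  calc ∫⁻ x, ‖f x‖ₑ ^ (3 : ℝ) ∂μ = ∫⁻ x, ‖f x‖ₑ * ‖f x‖ₑ ^ 2 ∂μ := by
        refine lintegral_congr fun x => ?_
        rw [show (3 : ℝ) = ((3 : ℕ) : ℝ) by norm_num, ENNReal.rpow_natCast, pow_succ']
    _ ≤ ∫⁻ x, eLpNorm f ∞ μ * ‖f x‖ₑ ^ 2 ∂μ := by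
        refine lintegral_mono_ae (hae.mono fun x hx => ?_)
        gcongr
    _ = eLpNorm f ∞ μ * ∫⁻ x, ‖f x‖ₑ ^ 2 ∂μ :=
        lintegral_const_mul'' _ (hf.enorm.pow_const 2)

/-- `‖f‖₃^q ≤ ‖f‖_∞^{q/3} (∫‖f‖²)^{q/3}` for `0 ≤ q`. -/
theorem eLpNorm_three_rpow_le_of_top_two {f : α → F} (hf : AEStronglyMeasurable f μ) {q : ℝ}
    (hq : 0 ≤ q) :
    eLpNorm f 3 μ ^ q ≤ eLpNorm f ∞ μ ^ (q / 3) * (∫⁻ x, ‖f x‖ₑ ^ 2 ∂μ) ^ (q / 3) := by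
  have hq3 : 0 ≤ q / 3 := by positivity
  rw [eLpNorm_eq_lintegral_rpow_enorm_toReal (by norm_num) (by norm_num)]
  simp only [ENNReal.toReal_ofNat]
  rw [← ENNReal.rpow_mul, show 1 / (3 : ℝ) * q = q / 3 by ring, ← ENNReal.mul_rpow_of_nonneg _ _ hq3]
  exact ENNReal.rpow_le_rpow (lintegral_enorm_rpow_three_le hf) hq3

end Interpolation

/-- **The interpolation jaw.** If on `(0,T)` every slice is a.e.-strongly measurable with
`‖u(t)‖_∞ ≤ c · g(t)` and `∫|u(t)|² ≤ e` (`c, e` finite), then for every `0 ≤ q`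
`∫₀ᵀ ‖u(t)‖₃^q dt ≤ c^{q/3} e^{q/3} ∫₀ᵀ g(t)^{q/3} dt`. -/
theorem lpTime_three_le_of_top_two {q T : ℝ} (hq : 0 ≤ q) {u : ℝ → E3 → E3}
    (hmeas : ∀ t ∈ Ioo 0 T, AEStronglyMeasurable (u t) volume) {c e : ℝ≥0∞} (hc : c ≠ ⊤)
    (he : e ≠ ⊤) {g : ℝ → ℝ≥0∞} (htop : ∀ t ∈ Ioo 0 T, eLpNorm (u t) ∞ volume ≤ c * g t)
    (htwo : ∀ t ∈ Ioo 0 T, ∫⁻ x, ‖u t x‖ₑ ^ 2 ≤ e) :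
    lpTime 3 q T u ≤ c ^ (q / 3) * e ^ (q / 3) * ∫⁻ t in Ioo 0 T, g t ^ (q / 3) := by
  have hq3 : 0 ≤ q / 3 := by positivity
  have hK : c ^ (q / 3) * e ^ (q / 3) ≠ ⊤ :=
    ENNReal.mul_ne_top (ENNReal.rpow_ne_top_of_nonneg hq3 hc) (ENNReal.rpow_ne_top_of_nonneg hq3 he)
  unfold lpTime
  rw [← lintegral_const_mul' _ _ hK]
  refine setLIntegral_mono' measurableSet_Ioo fun t ht => ?_
  calc eLpNorm (u t) 3 volume ^ q
      ≤ eLpNorm (u t) ∞ volume ^ (q / 3) * (∫⁻ x, ‖u t x‖ₑ ^ 2) ^ (q / 3) :=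
        eLpNorm_three_rpow_le_of_top_two (hmeas t ht) hq
    _ ≤ (c * g t) ^ (q / 3) * e ^ (q / 3) := by
        gcongr
        · exact htop t ht
        · exact htwo t ht
    _ = c ^ (q / 3) * e ^ (q / 3) * g t ^ (q / 3) := by
        rw [ENNReal.mul_rpow_of_nonneg _ _ hq3]; ring

/-- `∫₀ᵀ (t^{-1/2})^{q/3} dt < ∞` for `0 ≤ q < 6` (the integrand is `t^{-q/6}`). -/
theorem lintegral_Ioo_sqrtInv_rpow_lt_top {q T : ℝ} (hq0 : 0 ≤ q) (hq6 : q < 6) :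
    ∫⁻ t in Ioo 0 T, ENNReal.ofReal (t ^ (-(1 / 2 : ℝ))) ^ (q / 3) < ⊤ := by
  have hq3 : 0 ≤ q / 3 := by positivity
  have e : ∀ t ∈ Ioo (0 : ℝ) T,
      ENNReal.ofReal (t ^ (-(1 / 2 : ℝ))) ^ (q / 3) = ENNReal.ofReal (t ^ (-(q / 6))) := by
    intro t ht
    rw [ENNReal.ofReal_rpow_of_nonneg (Real.rpow_nonneg ht.1.le _) hq3, ← Real.rpow_mul ht.1.le]
    congr 2; ring
  rw [setLIntegral_congr_fun measurableSet_Ioo e]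
  by_cases hT : 0 < T
  swap
  · rw [Ioo_eq_empty hT]; simp
  have h := intervalIntegral.intervalIntegrable_rpow' (a := 0) (b := T) (by linarith : -1 < -(q / 6))
  have h' : IntegrableOn (fun t : ℝ => t ^ (-(q / 6))) (Ioo 0 T) :=
    (intervalIntegrable_iff_integrableOn_Ioo_of_le hT.le).1 h
  calc ∫⁻ t in Ioo 0 T, ENNReal.ofReal (t ^ (-(q / 6)))
      ≤ ∫⁻ t in Ioo 0 T, ‖t ^ (-(q / 6))‖ₑ := lintegral_ofReal_le_lintegral_enorm _
    _ < ⊤ := h'.2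

/-! ### The frame: measurability and the energy level -/

/-- The slices of a frame solution are a.e.-strongly measurable on `(0,T)` (they are smooth). -/
theorem frame_aestronglyMeasurable {ν T : ℝ} {u : ℝ → E3 → E3} {pr : ℝ → E3 → ℝ}
    (h : IsFrameSolution ν T u pr) {t : ℝ} (ht : t ∈ Ioo 0 T) :
    AEStronglyMeasurable (u t) volume :=
  (h.classical.contDiff_velocity ⟨ht.1.le, ht.2⟩).continuous.aestronglyMeasurable

/-- Energy inequality in the jaw's currency: `∫|u(t)|² ≤ ∫|u(0)|² = energy0 u` on `[0,T]`. -/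
theorem frame_lintegral_sq_le_energy0 {ν T : ℝ} (hν : 0 ≤ ν) {u : ℝ → E3 → E3}
    {pr : ℝ → E3 → ℝ} (h : IsFrameSolution ν T u pr) {t : ℝ} (ht : t ∈ Icc 0 T) :
    ∫⁻ x, ‖u t x‖ₑ ^ 2 ≤ energy0 u := by
  have h1 := h.lerayHopf.eEnergy_le_datum hν ht
  rw [← eEnergy_eq_ofReal _ (h.lerayHopf.memLp 0 ⟨le_rfl, ht.1.trans ht.2⟩)] at h1
  exact h1

/-! ### The critical smoothing modulus -/

/-- **CS(Φ): scale-invariant parabolic smoothing at the critical index.** Every frame solution with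
`‖u₀‖₃ ≤ A` obeys `‖u(t)‖_∞ ≤ √ν · Φ(A/ν) · t^{-1/2}` on `(0,T)` — the `ν`-covariant form of
`√t ‖u(t)‖_∞ ≤ Φ(‖u₀‖₃)` (`ν = 1`). Kato's small-data theory gives it with `Φ(a) = C a` for
`a ≤ ε₀`; for large `a` no finite `Φ` is known (a finite `Φ` on `[0, a]` for every `a` is
summit-strength, see the module docstring of the ROUND-12 memo). -/
@[conjecture] def CritSmoothing (Φ : ℝ → ℝ) : Prop :=
  ∀ ν T A : ℝ, 0 < ν → 0 < T → 0 ≤ A →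
    ∀ (u : ℝ → E3 → E3) (pr : ℝ → E3 → ℝ), IsFrameSolution ν T u pr →
      eLpNorm (u 0) 3 volume ≤ ENNReal.ofReal A →
        ∀ t ∈ Ioo 0 T, eLpNorm (u t) ∞ volume ≤
          ENNReal.ofReal (Real.sqrt ν * Φ (A / ν)) * ENNReal.ofReal (t ^ (-(1 / 2 : ℝ)))

/-- **CS: some finite critical smoothing modulus exists.** -/
@[conjecture] def CritSmoothingB : Prop := ∃ Φ : ℝ → ℝ, CritSmoothing Φ

/-- **CS(Φ) ⇒ QJ_data(q) for every `0 ≤ q < 6`** (kernel): on the slice `{E₀ ≤ E, ‖u₀‖₃ ≤ A}`,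
`∫₀ᵀ‖u‖₃^q ≤ (√ν Φ(A/ν))^{q/3} E^{q/3} ∫₀ᵀ t^{-q/6} dt = (√νΦ)^{q/3} E^{q/3} T^{1-q/6}/(1-q/6)`. -/
theorem quantJawData_of_critSmoothing {Φ : ℝ → ℝ} (hΦ : CritSmoothing Φ) {q : ℝ} (hq0 : 0 ≤ q)
    (hq6 : q < 6) : QuantJawData q := by
  intro ν T E A hν hT hE hA
  set c : ℝ≥0∞ := ENNReal.ofReal (Real.sqrt ν * Φ (A / ν)) with hc
  set I : ℝ≥0∞ := ∫⁻ t in Ioo 0 T, ENNReal.ofReal (t ^ (-(1 / 2 : ℝ))) ^ (q / 3) with hI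
  have hIt : I ≠ ⊤ := (lintegral_Ioo_sqrtInv_rpow_lt_top hq0 hq6).ne
  have hq3 : 0 ≤ q / 3 := by positivity
  have hKt : c ^ (q / 3) * ENNReal.ofReal E ^ (q / 3) * I ≠ ⊤ :=
    ENNReal.mul_ne_top (ENNReal.mul_ne_top (ENNReal.rpow_ne_top_of_nonneg hq3 ENNReal.ofReal_ne_top)
      (ENNReal.rpow_ne_top_of_nonneg hq3 ENNReal.ofReal_ne_top)) hIt
  refine ⟨(c ^ (q / 3) * ENNReal.ofReal E ^ (q / 3) * I).toNNReal, fun u pr hF hEu hAu => ?_⟩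
  rw [ENNReal.coe_toNNReal hKt]
  exact lpTime_three_le_of_top_two hq0 (fun t ht => frame_aestronglyMeasurable hF ht) ENNReal.ofReal_ne_top
    ENNReal.ofReal_ne_top (fun t ht => hΦ ν T A hν hT hA u pr hF hAu t ht)
    fun t ht => (frame_lintegral_sq_le_energy0 hν.le hF ⟨ht.1.le, ht.2.le⟩).trans hEu

/-- **CS(Φ) ⇒ the crux `L3CascadeJaw`**, by name. -/
theorem l3CascadeJaw_of_critSmoothing {Φ : ℝ → ℝ} (hΦ : CritSmoothing Φ) :
    Theses.L3TimeExponentPincer.L3CascadeJaw :=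
  l3CascadeJaw_of_quantJawData fun q hq4 hq5 =>
    quantJawData_of_critSmoothing hΦ (by linarith) (by linarith)

/-- **CS ⇒ the crux.** -/
theorem l3CascadeJaw_of_critSmoothingB (h : CritSmoothingB) :
    Theses.L3TimeExponentPincer.L3CascadeJaw := by
  obtain ⟨Φ, hΦ⟩ := h
  exact l3CascadeJaw_of_critSmoothing hΦ

/-! ### The swirl-free class: the Γ-indexed jaw is a theorem (modulo Gallay–Šverák (1.12)) -/

/-- From a pointwise bound `√t ‖v x‖ ≤ K` (`t > 0`): `‖v‖_∞ ≤ ofReal K · ofReal (t^{-1/2})`. -/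
theorem eLpNorm_top_le_of_sqrt_mul_le {v : E3 → E3} {t K : ℝ} (ht : 0 < t)
    (h : ∀ x, Real.sqrt t * ‖v x‖ ≤ K) :
    eLpNorm v ∞ volume ≤ ENNReal.ofReal K * ENNReal.ofReal (t ^ (-(1 / 2 : ℝ))) := by
  have hst : 0 < Real.sqrt t := Real.sqrt_pos.2 ht
  have hK : 0 ≤ K := le_trans (mul_nonneg hst.le (norm_nonneg _)) (h 0)
  have hpt : ∀ x, ‖v x‖ ≤ K * t ^ (-(1 / 2 : ℝ)) := fun x => by
    rw [Real.rpow_neg ht.le, ← Real.sqrt_eq_rpow, ← div_eq_mul_inv, le_div_iff₀ hst, mul_comm]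
    exact h x
  rw [eLpNorm_exponent_top, ← ENNReal.ofReal_mul hK]
  exact eLpNormEssSup_le_of_ae_bound (Filter.Eventually.of_forall hpt)

/-- **The swirl-free Γ-jaw** (modulo the Literature fact `GallaySverak2015.VelocitySupDecay`,
Gallay–Šverák 2015 (1.12)/(5.12)). Let `C` be the function of that fact. Along a Tao-class solution
(`ν = 1`) from an axisymmetric swirl-free datum with `ω_θ(0) ∈ L¹(Ω)`
(`M = ‖ω_θ(0)‖_{L¹(drdz)} = (2π)⁻¹∫|η₀|`) and energy level `∫|u(t)|² ≤ e` on `(0,T)`: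
`∫₀ᵀ ‖u(t)‖₃^q dt ≤ C(M)^{q/3} e^{q/3} ∫₀ᵀ t^{-q/6} dt` for every `0 ≤ q` — finite for `q < 6`
(`lintegral_Ioo_sqrtInv_rpow_lt_top`). A vorticity-indexed quantitative jaw for ALL `q < 6`. -/
theorem lpTime_three_le_noSwirl_of_velocitySupDecay (hF : GallaySverak2015.VelocitySupDecay) :
    ∃ C : ℝ → ℝ, (∃ K δ : ℝ, 0 < δ ∧ ∀ s, 0 ≤ s → s ≤ δ → C s ≤ K * s) ∧
      ∀ ⦃T : ℝ⦄ ⦃u₀ : E3 → E3⦄ ⦃u : ℝ → E3 → E3⦄ ⦃p : ℝ → E3 → ℝ⦄,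
        0 < T → IsTaoSolutionOn T 1 u₀ u p → IsAxisymmetric u₀ → HasNoSwirl u₀ →
        Integrable (angVortQuot u₀) →
        ∀ ⦃e : ℝ≥0∞⦄, e ≠ ⊤ → (∀ t ∈ Ioo 0 T, ∫⁻ x, ‖u t x‖ₑ ^ 2 ≤ e) →
        ∀ ⦃q : ℝ⦄, 0 ≤ q →
          lpTime 3 q T u ≤
            ENNReal.ofReal (C ((2 * Real.pi)⁻¹ * ∫ y, |angVortQuot u₀ y|)) ^ (q / 3) * e ^ (q / 3) *
              ∫⁻ t in Ioo 0 T, ENNReal.ofReal (t ^ (-(1 / 2 : ℝ))) ^ (q / 3) := by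
  obtain ⟨C, hC, hF⟩ := hF
  refine ⟨C, hC, fun T u₀ u p hT hsol h0 h0' hL1 e he hE q hq => ?_⟩
  refine lpTime_three_le_of_top_two hq (fun t ht => ?_) ENNReal.ofReal_ne_top he
    (fun t ht => eLpNorm_top_le_of_sqrt_mul_le ht.1 (hF hT hsol h0 h0' hL1 t ⟨ht.1, ht.2.le⟩)) hE
  exact (hsol.classical.contDiff_velocity ⟨ht.1.le, ht.2.le⟩).continuous.aestronglyMeasurable

/-! ### The swirl-free class, VELOCITY-indexed: the critical modulus as a typed open node -/

/-- **CS_ns(Φ): the velocity-indexed critical smoothing modulus in the swirl-free class** (Tao class,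
`ν = 1`): every Tao-class solution on `[0,T]` from an axisymmetric swirl-free datum with `‖u₀‖₃ ≤ A`
obeys `‖u(t)‖_∞ ≤ Φ(A) · t^{-1/2}` on `(0,T)`. Global regularity of the class is classical
(Ladyzhenskaya, Ukhovskii–Yudovich; tree `axisymmetric_no_swirl_global_regularity_holds`), and the
VORTICITY-indexed modulus (`A` replaced by `‖ω_θ(0)‖_{L¹(drdz)}`) is Gallay–Šverák (1.12); the
velocity-indexed modulus is the ROUND-12 candidate «first statement not in print» (memo §2): by
Jia–Šverák compactness (arXiv:1201.1592, Lemmas 5–6) it reduces to regularity of swirl-free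
suitable solutions with `L³` data of infinite energy and non-integrable `ω_θ`, a class not covered
by Ladyzhenskaya/U–Y (`H²`), Abidi (`H^{1/2}`) or Gallay–Šverák (`ω_θ(0) ∈ L¹(Ω)`); the blow-up
(sup-rescaling + KNSS Liouville) argument does NOT prove it (the limit may be a constant drift). -/
@[conjecture] def CritSmoothingNoSwirl (Φ : ℝ → ℝ) : Prop :=
  ∀ T A : ℝ, 0 < T → 0 ≤ A →
    ∀ (u₀ : E3 → E3) (u : ℝ → E3 → E3) (p : ℝ → E3 → ℝ),
      IsTaoSolutionOn T 1 u₀ u p → IsAxisymmetric u₀ → HasNoSwirl u₀ →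
      eLpNorm u₀ 3 volume ≤ ENNReal.ofReal A →
        ∀ t ∈ Ioo 0 T, eLpNorm (u t) ∞ volume ≤
          ENNReal.ofReal (Φ A) * ENNReal.ofReal (t ^ (-(1 / 2 : ℝ)))

/-- **CS_ns: a finite velocity-indexed critical modulus exists in the swirl-free class.** -/
@[conjecture] def CritSmoothingNoSwirlB : Prop := ∃ Φ : ℝ → ℝ, CritSmoothingNoSwirl Φ

/-- **CS_ns^poly: an EFFECTIVE (polynomial) velocity-indexed modulus in the swirl-free class** —
`√t ‖u(t)‖_∞ ≤ C (1 + ‖u₀‖₃)^m ‖u₀‖₃`-type growth, stated as `CritSmoothingNoSwirl (fun A => C * (1 + A) ^ m)`.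
The soft modulus `CritSmoothingNoSwirlB` has a compactness proof plan (ROUND-12 Addendum A) which
yields NO rate; any effective `Φ` is the open quantitative statement (memo §A.3). -/
@[conjecture] def CritSmoothingNoSwirlPoly : Prop :=
  ∃ C m : ℝ, CritSmoothingNoSwirl (fun A => C * (1 + A) ^ m)

/-- The effective modulus implies the soft one. -/
theorem critSmoothingNoSwirlB_of_poly (h : CritSmoothingNoSwirlPoly) : CritSmoothingNoSwirlB := by
  obtain ⟨C, m, h⟩ := h
  exact ⟨_, h⟩

/-- **CS_ns(Φ) ⇒ the velocity-indexed swirl-free jaw** (kernel): along a Tao-class swirl-free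
solution with `‖u₀‖₃ ≤ A` and energy level `e` on `(0,T)`,
`∫₀ᵀ‖u‖₃^q ≤ Φ(A)^{q/3} e^{q/3} ∫₀ᵀ t^{-q/6} dt` for every `0 ≤ q` (finite for `q < 6`). -/
theorem lpTime_three_le_noSwirl_of_critSmoothingNoSwirl {Φ : ℝ → ℝ} (hΦ : CritSmoothingNoSwirl Φ)
    {T A : ℝ} (hT : 0 < T) (hA : 0 ≤ A) {u₀ : E3 → E3} {u : ℝ → E3 → E3} {p : ℝ → E3 → ℝ}
    (hsol : IsTaoSolutionOn T 1 u₀ u p) (h0 : IsAxisymmetric u₀) (h0' : HasNoSwirl u₀)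
    (hA' : eLpNorm u₀ 3 volume ≤ ENNReal.ofReal A) {e : ℝ≥0∞} (he : e ≠ ⊤)
    (hE : ∀ t ∈ Ioo 0 T, ∫⁻ x, ‖u t x‖ₑ ^ 2 ≤ e) {q : ℝ} (hq : 0 ≤ q) :
    lpTime 3 q T u ≤ ENNReal.ofReal (Φ A) ^ (q / 3) * e ^ (q / 3) *
      ∫⁻ t in Ioo 0 T, ENNReal.ofReal (t ^ (-(1 / 2 : ℝ))) ^ (q / 3) := by
  refine lpTime_three_le_of_top_two hq (fun t ht => ?_) ENNReal.ofReal_ne_top he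
    (fun t ht => hΦ T A hT hA u₀ u p hsol h0 h0' hA' t ht) hE
  exact (hsol.classical.contDiff_velocity ⟨ht.1.le, ht.2.le⟩).continuous.aestronglyMeasurable

/-! ### Ring saturation: the Γ-jaw meets ROUND-11's floor at the ring lifetime -/

/-- Real algebra: `E^{q/3} Γ^{q/3} (E²/Γ⁴)^{1-q/6} = E² Γ^{q-4}` (`E, Γ > 0`). At the ring lifetime
`T = ℓ²/ν = E²/Γ⁴` (energy-normalised ring: `E ≍ U²ℓ³ = Γ²ℓ`) the swirl-free Γ-jaw
`E^{q/3}Γ^{q/3}T^{1-q/6}` equals the persistence floor `E²Γ^{q-4}` of ROUND-11 (`A^{q-4}`-growth). -/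
theorem ring_saturation_identity {E Γ q : ℝ} (hE : 0 < E) (hΓ : 0 < Γ) :
    E ^ (q / 3) * Γ ^ (q / 3) * (E ^ 2 / Γ ^ 4) ^ (1 - q / 6) = E ^ 2 * Γ ^ (q - 4) := by
  have h1 : (E ^ 2 / Γ ^ 4) ^ (1 - q / 6) = E ^ (2 * (1 - q / 6)) / Γ ^ (4 * (1 - q / 6)) := by
    rw [Real.div_rpow (by positivity) (by positivity), ← Real.rpow_natCast E 2,
      ← Real.rpow_natCast Γ 4, ← Real.rpow_mul hE.le, ← Real.rpow_mul hΓ.le]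
    norm_num
  calc E ^ (q / 3) * Γ ^ (q / 3) * (E ^ 2 / Γ ^ 4) ^ (1 - q / 6)
      = (E ^ (q / 3) * E ^ (2 * (1 - q / 6))) * (Γ ^ (q / 3) / Γ ^ (4 * (1 - q / 6))) := by
        rw [h1]; ring
    _ = E ^ (q / 3 + 2 * (1 - q / 6)) * Γ ^ (q / 3 - 4 * (1 - q / 6)) := by
        rw [Real.rpow_add hE, Real.rpow_sub hΓ]
    _ = E ^ 2 * Γ ^ (q - 4) := by
        rw [show q / 3 + 2 * (1 - q / 6) = ((2 : ℕ) : ℝ) by push_cast; ring, Real.rpow_natCast,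
          show q / 3 - 4 * (1 - q / 6) = q - 4 by ring]

end Summit.NavierStokesRegularity.NavierStokesRegularity.Theorems.L3TimeExponentPincerCritModulus
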